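import Mathlib.Tactic
import HarnessLib

/-!
# Kozma–Nitzan's Question 8 — the realisable region of the suffix channels: `u·v + η·p ≤ m·(1−p)` (gen 45)

Support file (`--supports stmt-CriticalPhenomena-4575`, closed crux; independent mathematics on Kozma–Nitzan's Question 8,
arXiv:2401.12397 §5.5 p. 36), prover `prim-ineq-gen-6` (gen 45).  No definitions, no named facts, no sorries; standard axioms.
Memo `run/shared/lean/prim/prim-ineq-gen-6/PROOF-UBD2-G45.md` §5 (LEMMA CH, LEMMA CH⁺⁺).

A suffix path `T` of a path-end block is summarised by its CHANNELS `u = π−m` (first fragment C-good ∧ A-bad, rest good),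
`v = ε−m` (A-good ∧ C-bad, rest good), `m` (both good, rest good), `p = Φ(T) = u+v+m`, and the fourth channel `η = ν − m`
(first fragment both good, rest NOT good).  Along the suffix recursion `T = b(A,C) –s– T″`:
`m̃ = (1−s)p″ + s m″`, `u = C(1−A)m̃ + sCu″`, `v = A(1−C)m̃ + sAv″`, `m = ACm̃`, `η̃ = (1−s)(1−p″) + sη″`, `η = ACη̃`.
LEMMA CH: `u·v ≤ m·(1−p)` and LEMMA CH⁺⁺: `u·v + η·p ≤ m·(1−p)` hold for every suffix (equality for a single vertex), by induction:
`kCH_base`, `kCH_step`, `kCHpp_step` below are the base and the inductive steps (exact identities `m(1−p) − uv = AC·(m̃(1−p″) − s²u″v″)`,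
`p″ − p = (1−A)(1−C)m̃ + s(1−C)u″ + s(1−A)v″`).  These constraints are what distinguishes realisable channel vectors from the free
simplex: with them the top contraction step of the UB(Ψ̂) programme holds on 1.5·10⁶ free samples, without them it fails (memo §4–§5).
[cite: KozmaNitzan2024, Question 8 (§5.5 p. 36)]
-/

namespace Summit.CriticalPhenomena.PercolationContinuityZ3.Theorems

namespace PocketCert

/-- **LEMMA CH, base (single vertex).**  For a vertex with marks `A, C`: `u = C(1−A)`, `v = A(1−C)`, `m = AC` satisfy
`u·v = m·(1 − u − v − m)` (the dead mass is `(1−A)(1−C)`).  [cite: KozmaNitzan2024, Question 8 (§5.5 p. 36)] -/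
theorem kCH_base (A C : ℝ) :
    (C * (1 - A)) * (A * (1 - C)) = (A * C) * (1 - C * (1 - A) - A * (1 - C) - A * C) := by
  ring

/-- **LEMMA CH, inductive step.**  If the suffix `T″` has channels `u″, v″, m″ ≥ 0`, `p″ = u″+v″+m″ ≤ 1` with `u″v″ ≤ m″(1−p″)`,
then `T = b(A,C) –s– T″` (`A, C ≥ 0`, `0 ≤ s ≤ 1`) has `u·v ≤ m·(1−p)`.  [cite: KozmaNitzan2024, Question 8 (§5.5 p. 36)] -/
theorem kCH_step (A C s u'' v'' m'' mt u v m : ℝ)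
    (hA0 : 0 ≤ A) (hC0 : 0 ≤ C) (hs0 : 0 ≤ s) (hs1 : s ≤ 1)
    (hu : 0 ≤ u'') (hv : 0 ≤ v'') (hm : 0 ≤ m'') (hp : u'' + v'' + m'' ≤ 1)
    (hIH : u'' * v'' ≤ m'' * (1 - u'' - v'' - m''))
    (hmt : mt = (1 - s) * (u'' + v'' + m'') + s * m'') (hU : u = C * (1 - A) * mt + s * C * u'')
    (hV : v = A * (1 - C) * mt + s * A * v'') (hM : m = A * C * mt) :
    u * v ≤ m * (1 - u - v - m) := by
  have key : m * (1 - u - v - m) - u * v = A * C * (mt * (1 - u'' - v'' - m'') - s ^ 2 * (u'' * v'')) := by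
    rw [hU, hV, hM, hmt]; ring
  have hd : 0 ≤ 1 - u'' - v'' - m'' := by linarith
  have hmt_ge : s * m'' ≤ mt := by
    rw [hmt]; nlinarith [mul_nonneg (by linarith : (0:ℝ) ≤ 1 - s) (by linarith : (0:ℝ) ≤ u'' + v'' + m'')]
  have huv : 0 ≤ u'' * v'' := mul_nonneg hu hv
  -- mt·d ≥ s m″ d ≥ s u″v″ ≥ s² u″v″
  have h1 : s * (m'' * (1 - u'' - v'' - m'')) ≤ mt * (1 - u'' - v'' - m'') := by
    have := mul_le_mul_of_nonneg_right hmt_ge hd; linarith [this]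
  have h2 : s * (u'' * v'') ≤ s * (m'' * (1 - u'' - v'' - m'')) := mul_le_mul_of_nonneg_left hIH hs0
  have h3 : s ^ 2 * (u'' * v'') ≤ s * (u'' * v'') := by nlinarith [mul_nonneg hs0 huv]
  have hcore : 0 ≤ mt * (1 - u'' - v'' - m'') - s ^ 2 * (u'' * v'') := by linarith
  have hAC : 0 ≤ A * C := mul_nonneg hA0 hC0
  have : 0 ≤ m * (1 - u - v - m) - u * v := by rw [key]; exact mul_nonneg hAC hcore
  linarith

/-- **LEMMA CH⁺⁺, inductive step (with the fourth channel).**  If `T″` has `u″, v″, m″, η″ ≥ 0`, `p″ ≤ 1` and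
`u″v″ + η″p″ ≤ m″(1−p″)`, then `T = b(A,C) –s– T″` satisfies `u·v + η·p ≤ m·(1−p)` with `η = AC·((1−s)(1−p″) + sη″)`.
[cite: KozmaNitzan2024, Question 8 (§5.5 p. 36)] -/
theorem kCHpp_step (A C s u'' v'' m'' η'' mt u v m η : ℝ)
    (hA0 : 0 ≤ A) (hA1 : A ≤ 1) (hC0 : 0 ≤ C) (hC1 : C ≤ 1) (hs0 : 0 ≤ s) (hs1 : s ≤ 1)
    (hu : 0 ≤ u'') (hv : 0 ≤ v'') (hm : 0 ≤ m'') (hη : 0 ≤ η'') (hp : u'' + v'' + m'' ≤ 1)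
    (hIH : u'' * v'' + η'' * (u'' + v'' + m'') ≤ m'' * (1 - u'' - v'' - m''))
    (hmt : mt = (1 - s) * (u'' + v'' + m'') + s * m'') (hU : u = C * (1 - A) * mt + s * C * u'')
    (hV : v = A * (1 - C) * mt + s * A * v'') (hM : m = A * C * mt)
    (hE : η = A * C * ((1 - s) * (1 - u'' - v'' - m'') + s * η'')) :
    u * v + η * (u + v + m) ≤ m * (1 - u - v - m) := by
  -- exact identities
  have key : m * (1 - u - v - m) - u * v - η * (u + v + m)
      = A * C * (mt * (1 - u'' - v'' - m'') - s ^ 2 * (u'' * v'')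
          - ((1 - s) * (1 - u'' - v'' - m'') + s * η'') * (u + v + m)) := by
    rw [hU, hV, hM, hE, hmt]; ring
  have hgap : (u'' + v'' + m'') - (u + v + m)
      = (1 - A) * (1 - C) * mt + s * (1 - C) * u'' + s * (1 - A) * v'' := by
    rw [hU, hV, hM, hmt]; ring
  have hd : 0 ≤ 1 - u'' - v'' - m'' := by linarith
  have hmt0 : 0 ≤ mt := by
    rw [hmt]; exact add_nonneg (mul_nonneg (by linarith) (by linarith)) (mul_nonneg hs0 hm)
  have hetat : 0 ≤ (1 - s) * (1 - u'' - v'' - m'') + s * η'' :=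
    add_nonneg (mul_nonneg (by linarith) hd) (mul_nonneg hs0 hη)
  -- P ≤ p″
  have hPle : u + v + m ≤ u'' + v'' + m'' := by
    have : 0 ≤ (1 - A) * (1 - C) * mt + s * (1 - C) * u'' + s * (1 - A) * v'' :=
      add_nonneg (add_nonneg (mul_nonneg (mul_nonneg (by linarith) (by linarith)) hmt0)
        (mul_nonneg (mul_nonneg hs0 (by linarith)) hu)) (mul_nonneg (mul_nonneg hs0 (by linarith)) hv)
    linarith [hgap]
  have hEP : ((1 - s) * (1 - u'' - v'' - m'') + s * η'') * (u + v + m)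
      ≤ ((1 - s) * (1 - u'' - v'' - m'') + s * η'') * (u'' + v'' + m'') :=
    mul_le_mul_of_nonneg_left hPle hetat
  -- mt d − η̃ p″ − s²u″v″ = s (m″d″ − η″p″ − s u″v″) ≥ s (m″d″ − η″p″ − u″v″) ≥ 0
  have hid : mt * (1 - u'' - v'' - m'') - ((1 - s) * (1 - u'' - v'' - m'') + s * η'') * (u'' + v'' + m'') - s ^ 2 * (u'' * v'')
      = s * (m'' * (1 - u'' - v'' - m'') - η'' * (u'' + v'' + m'') - s * (u'' * v'')) := by
    rw [hmt]; ring
  have huv : 0 ≤ u'' * v'' := mul_nonneg hu hv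
  have hin : 0 ≤ m'' * (1 - u'' - v'' - m'') - η'' * (u'' + v'' + m'') - s * (u'' * v'') := by
    nlinarith [mul_nonneg (by linarith : (0:ℝ) ≤ 1 - s) huv]
  have hcore : 0 ≤ mt * (1 - u'' - v'' - m'') - s ^ 2 * (u'' * v'')
      - ((1 - s) * (1 - u'' - v'' - m'') + s * η'') * (u + v + m) := by
    have h0 : 0 ≤ s * (m'' * (1 - u'' - v'' - m'') - η'' * (u'' + v'' + m'') - s * (u'' * v'')) := mul_nonneg hs0 hin
    linarith [hid, hEP, h0]
  have hAC : 0 ≤ A * C := mul_nonneg hA0 hC0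
  have : 0 ≤ m * (1 - u - v - m) - u * v - η * (u + v + m) := by rw [key]; exact mul_nonneg hAC hcore
  linarith

/-- **Consequence used by the free-variable analysis:** `u·v ≤ m·(1−p)` alone implies the
square-root constraint in polynomial form, `4uv ≤ (1 − u − v)²` (i.e. `√u + √v ≤ 1` when `u, v ≥ 0`, `u + v ≤ 1`), since `4m(1−u−v−m) ≤ (1−u−v)²`.  [cite: KozmaNitzan2024, Question 8 (§5.5 p. 36)] -/
theorem kCH_sqrt (u v m : ℝ) (h : u * v ≤ m * (1 - u - v - m)) : 4 * (u * v) ≤ (1 - u - v) ^ 2 := by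
  nlinarith [sq_nonneg (m - (1 - u - v - m))]

end PocketCert

end Summit.CriticalPhenomena.PercolationContinuityZ3.Theorems
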